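import Literature.AnabelianGeometry.EtaleTheta.Discharge.Sec2Rmk261UniversalClosureRefuted
import Literature.AnabelianGeometry.EtaleTheta.Discharge.Sec2AutKHolds
import HarnessLib

/-!
# [EtTh] Remark 2.6.1 at abc-iut-w5-d118's model of `TemperedCoverData`, clause by clause: `C̲̲` and `C̲` HOLD,
# `X̲̲` and `Ẋ̲̲` FAIL (proof-only; sharpening of the F-0612 / F-0613 independence certificate)

S. Mochizuki, *The étale theta function and its Frobenioid-theoretic manifestations*, Publ. RIMS **45**
(2009) [MochizukiEtTh2009], §2, Remark 2.6.1, PRIMS PDF p. 40 (printed p. 266): "`Aut_K(X̲̲^log) = μ_l × {±1}`;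
`Aut_K(X̲^log) = ℤ/lℤ ⋊ {±1}`; `Aut_K(C̲̲^log) = μ_l`; `Aut_K(C̲^log) = {1}`" [cite: MochizukiEtTh2009, Rmk 2.6.1 p.40].

abc-iut cell, block C / F (FACT-PROVING WAVE, seat abc-iut-f-144; rows F-0612 `TemperedCoverData.Rmk261`, F-0613
`TemperedCoverData.Rmk261_dotted`). PROOF-ONLY sequel (0 definitions) of `Discharge/Sec2Rmk261UniversalClosureRefuted.lean`
(p432362: the universal closures fail at the model through the `X̲̲`/`Ẋ̲̲`-clauses). This file makes the READING
paragraph of that file kernel-checked: at the SAME model the `C̲̲`-clause (`Aut_K(C̲̲) ≅ ℤ/l`) and the `C̲`-clause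
(`Aut_K(C̲) = 1`) HOLD — so, at the interface level, the printed definition `hΘ` of `Δ̄_Θ` (GAP-LEDGER G-L2d3-1;
v-next census S2-3) is needed EXACTLY for the clauses involving `X̲̲`.

* `TemperedModel.barThetaM_le_zpowers_sup_barKerM` — in the model `Δ̄_Θ = Ẑ/lẐ` is CYCLIC in abc-iut-L2-d3's
  instance-free sense: `Δ̄_Θ`-preimage `⊆ t^ℤ · Ker` for `t := (1, η_ℤ(1))`.
* `TemperedModel.exists_model_autK_clauses` — at the model (`l` odd): `K ⊇ μ_l`; `Aut_K(C̲̲) ≅ ℤ/l` (abc-iut-L2-d3's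
  `nonempty_autK_tpPiCuu_mulEquiv_of_cyclic`, p419607, fed with the cyclicity above); `Aut_K(C̲) = 1`
  (abc-iut-L6-t23's unconditional `autK_tpPiCu_subsingleton`); `#Aut_K(X̲̲) = 2l²`, `#Aut_K(Ẋ̲̲) = 4l²` (p432362).
* `TemperedModel.exists_model_rmk261_clauses` — hence for odd `l ≠ 1`: clauses `C̲̲`, `C̲` of the typed `Rmk261` hold
  and clause `X̲̲` (and the `Ẋ̲̲`-clause of `Rmk261_dotted`) fail, at one and the same `T` with `T.HasMuL`.

HONEST FRAMING: statements about the cell's typed interface at a DEGENERATE consistency witness (`G_K = 1`); the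
printed Remark 2.6.1 is neither refuted nor proved; nothing bears on [IUTchIII] Cor. 3.12; no side is taken;
typed ≠ proved.
-/

noncomputable section

namespace Literature.AnabelianGeometry.EtaleTheta

namespace ThetaCovers

namespace TemperedModel

open Multiplicative HeisenbergWitness Literature.AnabelianGeometry.SemiGraphs
  Literature.AnabelianGeometry.EtaleTheta.SettingModel

variable (l : ℕ) [NeZero l]

/-- **`Δ̄_Θ` is cyclic in the model** (instance-free form of abc-iut-L2-d3): every element of `Δ̄_Θ`-preimage
`Φ⁻¹(heisTheta)` is `t^k · y` with `t = (1, η_ℤ(1))` and `y ∈ Ker(Δ_X ↠ Δ̄_X) = Φ⁻¹(heisTheta) ∩ Ker Ψ` — take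
`k ≡ Ψ(x) (mod l)`. (toy bookkeeping) [cite: MochizukiEtTh2009, Def 2.1 p.35] -/
theorem barThetaM_le_zpowers_sup_barKerM :
    barThetaM l ≤ Subgroup.zpowers (((1 : Ahat l), etaCont (Multiplicative ℤ) (ofAdd 1)) : PiCM l) ⊔ barKerM l := by
  intro x hx
  set t : PiCM l := ((1 : Ahat l), etaCont (Multiplicative ℤ) (ofAdd 1)) with ht
  obtain ⟨k, hk⟩ := ZMod.intCast_surjective (toAdd (Psi l x))
  have hΨt : Psi l t = ofAdd ((1 : ℤ) : ZMod l) := by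
    rw [ht, Psi_eta, toAdd_ofAdd]
  have e : x = t ^ k * (t ^ (-k) * x) := by group
  rw [e]
  refine Subgroup.mul_mem_sup (Subgroup.zpow_mem_zpowers _ _) ?_
  show t ^ (-k) * x ∈ barThetaM l ⊓ (Psi l).ker
  refine Subgroup.mem_inf.mpr ⟨mul_mem (zpow_mem (one_prod_mem_barThetaM l _) _) hx, ?_⟩
  rw [MonoidHom.mem_ker, map_mul, map_zpow, hΨt, ← ofAdd_toAdd (Psi l x), ← hk, Int.cast_one,
    ← ofAdd_zsmul, ← ofAdd_add, ofAdd_eq_one, zsmul_eq_mul, mul_one, Int.cast_neg, neg_add_cancel]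

/-- **The model, clause by clause** (`l` odd): a `T : TemperedCoverData l` (abc-iut-w5-d118's structure literal) with
`K ⊇ μ_l` at which `Aut_K(C̲̲) ≅ ℤ/l` and `Aut_K(C̲) = 1` HOLD while `#Aut_K(X̲̲) = 2l²` and `#Aut_K(Ẋ̲̲) = 4l²`.
[cite: MochizukiEtTh2009, Rmk 2.6.1 p.40] -/
theorem exists_model_autK_clauses (hl : Odd l) : ∃ T : TemperedCoverData.{0} l,
    T.HasMuL ∧ Nonempty (T.autK (T.tp T.PiCuu) ≃* Multiplicative (ZMod l)) ∧
      Subsingleton (T.autK (T.tp T.PiCu)) ∧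
      Nat.card (T.autK (T.tp T.PiXuu)) = 2 * l * l ∧
      Nat.card (T.autK (T.tp T.PiXuu ⊓ T.PiCdot)) = 2 * l * 2 * l := by
  haveI := TAX_normal l
  haveI : ((TAX l).prod (⊥ : Subgroup (Multiplicative ℤ))).Normal := Subgroup.prod_normal _ _
  let T : TemperedCoverData.{0} l :=
    { toCoverDataAx := coverDataAx l hl
      PiCuu := PiCuuM l
      isTypeLTorsThetaPm := isTypeLTorsThetaPm_PiCuuM l hl
      isOpen_PiCuu' := isOpen_PiCuuM l
      Gtp := GtpM l
      toHat := (toHatM l).toMonoidHom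
      continuous_toHat := (toHatM l).continuous
      injective_toHat := toHatM_injective l
      isProfiniteCompletion_toHat := isProfiniteCompletion_prodMap_etaCont (TA l) (Multiplicative ℤ)
      PiYtp := (TAX l).prod ⊥
      PiYtp_le := by
        change (TAX l).prod ⊥ ≤ (PiXM l).comap (toHatM l).toMonoidHom
        rw [comap_toHatM_PiXM]
        exact Subgroup.prod_mono le_rfl bot_le
      PiYtp_normal := inferInstance
      isOpen_PiYtp := isOpen_discrete _
      quotZ := nonempty_quotZ l
      PiYddtp := ((TAX l ⊓ (TA.two l).ker)).prod ⊥
      PiYddtp_le := Subgroup.prod_mono inf_le_left le_rfl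
      isOpen_PiYddtp := isOpen_discrete _
      relIndex_PiYddtp := relIndex_PiYddtp l
      PiCdot := ((TA.two l).ker).prod ⊤
      index_PiCdot := index_PiCdot l
      isOpen_PiCdot := isOpen_discrete _
      PiCdot_ne := PiCdot_ne l }
  have hXuu : T.tp T.PiXuu = (PiCuuM l ⊓ PiXM l).comap (toHatM l).toMonoidHom := rfl
  have hXuuD : T.tp T.PiXuu ⊓ T.PiCdot =
      (PiCuuM l ⊓ PiXM l).comap (toHatM l).toMonoidHom ⊓ ((TA.two l).ker).prod ⊤ := rfl
  haveI h1 : (T.tp T.PiXuu).Normal := by rw [hXuu]; exact tpPiXuuM_normal l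
  haveI h2 : (T.tp T.PiXuu ⊓ T.PiCdot).Normal := by rw [hXuuD]; exact tpPiXuuM_inf_PiCdot_normal l
  have hmu : T.HasMuL := fun c t ht => hasMuL_model l hl c ht
  have hcyc : ∃ t ∈ T.barTheta, T.barTheta ≤ Subgroup.zpowers t ⊔ T.barKer :=
    ⟨_, one_prod_mem_barThetaM l _, barThetaM_le_zpowers_sup_barKerM l⟩
  refine ⟨T, hmu, T.nonempty_autK_tpPiCuu_mulEquiv_of_cyclic hcyc hmu, T.autK_tpPiCu_subsingleton, ?_, ?_⟩
  · rw [T.natCard_autK_eq_index, hXuu, index_tpPiXuuM]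
  · rw [T.natCard_autK_eq_index, hXuuD, index_tpPiXuuM_inf_PiCdot]

/-- **Remark 2.6.1 at the model, clause by clause** (`l` odd, `l ≠ 1`): at one and the same `T` with `K ⊇ μ_l`, the
`C̲̲`-clause `Aut_K(C̲̲) ≅ ℤ/l` and the `C̲`-clause `Aut_K(C̲) = 1` of the typed `Rmk261` HOLD, whereas its `X̲̲`-clause
`Aut_K(X̲̲) ≅ ℤ/l × ℤ/2` and the `Ẋ̲̲`-clause `Aut_K(Ẋ̲̲) ≅ (ℤ/l × ℤ/2) × ℤ/2` of `Rmk261_dotted` FAIL: the binder `hΘ`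
(G-L2d3-1) matters exactly for the members built from `Π_{X̲̲}`. [cite: MochizukiEtTh2009, Rmk 2.6.1 p.40] -/
theorem exists_model_rmk261_clauses (hl : Odd l) (hl1 : l ≠ 1) : ∃ T : TemperedCoverData.{0} l,
    T.HasMuL ∧ Nonempty (T.autK (T.tp T.PiCuu) ≃* Multiplicative (ZMod l)) ∧
      Subsingleton (T.autK (T.tp T.PiCu)) ∧
      ¬ Nonempty (T.autK (T.tp T.PiXuu) ≃* Multiplicative (ZMod l) × Multiplicative (ZMod 2)) ∧
      ¬ Nonempty (T.autK (T.tp T.PiXuu ⊓ T.PiCdot) ≃*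
          (Multiplicative (ZMod l) × Multiplicative (ZMod 2)) × Multiplicative (ZMod 2)) := by
  obtain ⟨T, hmu, hCuu, hCu, hXuu, hXuuD⟩ := exists_model_autK_clauses l hl
  have hl0 : 0 < l := Nat.pos_of_ne_zero (NeZero.ne l)
  refine ⟨T, hmu, hCuu, hCu, ?_, ?_⟩
  · rintro ⟨e⟩
    have h2 : Nat.card (T.autK (T.tp T.PiXuu)) = l * 2 := by
      rw [Nat.card_congr e.toEquiv, Nat.card_prod]
      simp only [Nat.card_eq_fintype_card, Fintype.card_multiplicative, ZMod.card]
    rw [hXuu] at h2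
    have : 2 * l * l = 2 * l * 1 := by rw [h2]; ring
    exact hl1 (Nat.eq_of_mul_eq_mul_left (by omega) this)
  · rintro ⟨e⟩
    have h2 : Nat.card (T.autK (T.tp T.PiXuu ⊓ T.PiCdot)) = l * 2 * 2 := by
      rw [Nat.card_congr e.toEquiv, Nat.card_prod, Nat.card_prod]
      simp only [Nat.card_eq_fintype_card, Fintype.card_multiplicative, ZMod.card]
    rw [hXuuD] at h2
    have : 4 * l * l = 4 * l * 1 := by
      have e1 : 2 * l * 2 * l = 4 * l * l := by ring
      rw [← e1, h2]; ring
    exact hl1 (Nat.eq_of_mul_eq_mul_left (by omega) this)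

end TemperedModel

end ThetaCovers

end Literature.AnabelianGeometry.EtaleTheta

end
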